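import Mathlib
import Literature.Computability.AlgebraicComplexity.PermanentIrreducible
import Literature.Computability.AlgebraicComplexity.StandardFamiliesProofs
import Summits.ValiantsHypothesis.ValiantsHypothesis.Theorems.DivisionGapPerCofactorDegreeReductionStubTwoTowerCollapse

/-!
# Crux `DivisionGap.PerCofactorDegreeReduction` (stmt-ValiantsHypothesis-15046), line `Sketch` —
# stub `stub_binaryFormCollapse`: every nonnegative binary-form relation modulo the permanent is
# carried by one antipodal pair

**Theorem (`stub_binaryFormCollapse`).** Let `n ≥ 1`, let `u, u' ∈ ℝ≥0[x_ij]` (`n × n` variables)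
be not divisible by `per_n` over `ℝ`, let `c₀, …, c_N ≥ 0` be not all zero, and suppose
`per_n ∣ ∑ᵢ cᵢ uⁱ u'^{N-i}` over `ℝ`.  Then `per_n ∣ u + γ u'` over `ℝ` for some real `γ > 0`.

## Proof

The constants principle; no homogeneity and no unique factorisation of the quotient are needed.
* §1 *Binary forms in a domain.* Let `S` be a domain containing `ℂ` (via `κ : ℂ →+* S`), `B ≠ 0`,
  and `∑ᵢ κ(cᵢ) Aⁱ B^{N-i} = 0` with `c ≠ 0`.  In the fraction field `K` of `S` put `t = A / B`;
  then `B^N · P(t) = ∑ᵢ cᵢ Aⁱ B^{N-i} = 0` for the nonzero polynomial `P = ∑ᵢ cᵢ Tⁱ ∈ ℂ[T]`, so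
  `t` is a root of `P` in `K`.  Since `P` splits over the algebraically closed field `ℂ`
  (`IsAlgClosed.splits`, `Polynomial.Splits.mem_range_of_isRoot`), `t = κ(r)` for a root
  `r ∈ ℂ` of `P`, i.e. `A = κ(r) B` in `S` (`exists_root_of_binaryForm_eq_zero`).
* §2 *The theorem.* `S = ℂ[x]/(per_n)` is a domain (`perPoly_irreducible`, irreducible is prime in
  the UFD `ℂ[x]`).  Bars denote classes of complexifications; `ū, ū' ≠ 0` by descent of
  divisibility from `ℂ` to `ℝ` (`TwoTowerCollapse.per_descent`), and the hypothesis reads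
  `∑ᵢ c̄ᵢ ūⁱ ū'^{N-i} = 0`.  By §1, `ū = r̄ ū'` with `P(r) = ∑ cᵢ rⁱ = 0`.  The constant `r` is
  real (imaginary parts: `TwoTowerCollapse.dvd_of_map_dvd_sub_C_mul`, else `per_n ∣ u'`),
  nonzero (else `ū = 0`), and not positive (else `P(r) > 0`, all `cᵢ ≥ 0` and some `cᵢ > 0`).
  Hence `r < 0`, and `γ = -r > 0` gives `ū + γ̄ ū' = 0`, i.e. `per_n ∣ u + γ u'` over `ℂ`, hence
  over `ℝ` (`per_descent`).
-/

noncomputable section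

-- `Summit.ValiantsHypothesis.ValiantsHypothesis.…` is the tree's mandated single-conjunct layout
-- (Problem = Summit), so the duplicated namespace component is intended.
set_option linter.dupNamespace false

namespace Summit.ValiantsHypothesis.ValiantsHypothesis.Theorems.DivisionGap.PerCofactorDegreeReduction.BinaryFormCollapse

open MvPolynomial Literature.Computability.AlgebraicComplexity
open Summit.ValiantsHypothesis.ValiantsHypothesis.Theorems.DivisionGap.PerCofactorDegreeReduction.TwoTowerCollapse
  (per_descent per_ascent dvd_of_map_dvd_sub_C_mul)
open scoped NNReal BigOperators

/-! ### §1 Binary forms vanishing in a domain containing `ℂ` -/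

/-- Evaluation of `∑ᵢ cᵢ Tⁱ` at `x`. [folklore] -/
theorem eval_sum_C_mul_X_pow {R : Type*} [CommSemiring R] {m : ℕ} (c : Fin m → R) (x : R) :
    (∑ i : Fin m, Polynomial.C (c i) * Polynomial.X ^ (i : ℕ)).eval x =
      ∑ i : Fin m, c i * x ^ (i : ℕ) := by
  simp only [Polynomial.eval_finsetSum, Polynomial.eval_mul, Polynomial.eval_C,
    Polynomial.eval_pow, Polynomial.eval_X]

/-- Evaluation of the image of `∑ᵢ cᵢ Tⁱ` under a ring map `φ` at `x`. [folklore] -/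
theorem eval_map_sum_C_mul_X_pow {R T : Type*} [CommSemiring R] [CommSemiring T] (φ : R →+* T)
    {m : ℕ} (c : Fin m → R) (x : T) :
    ((∑ i : Fin m, Polynomial.C (c i) * Polynomial.X ^ (i : ℕ)).map φ).eval x =
      ∑ i : Fin m, φ (c i) * x ^ (i : ℕ) := by
  simp only [Polynomial.map_sum, Polynomial.map_mul, Polynomial.map_C, Polynomial.map_pow,
    Polynomial.map_X, Polynomial.eval_finsetSum, Polynomial.eval_mul, Polynomial.eval_C,
    Polynomial.eval_pow, Polynomial.eval_X]

/-- **Binary forms over `ℂ` factor into linear forms.** Let `S` be a domain with a ring map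
`κ : ℂ → S`, let `c₀, …, c_N ∈ ℂ` be not all zero, `B ≠ 0`, and `∑ᵢ κ(cᵢ) Aⁱ B^{N-i} = 0` in `S`.
Then `A = κ(r) B` for some root `r ∈ ℂ` of `∑ᵢ cᵢ Tⁱ`: in the fraction field of `S`, `t = A / B`
is a root of the nonzero polynomial `∑ᵢ cᵢ Tⁱ`, which splits over `ℂ`. [folklore] -/
theorem exists_root_of_binaryForm_eq_zero {S : Type*} [CommRing S] [IsDomain S] (κ : ℂ →+* S)
    {N : ℕ} {c : Fin (N + 1) → ℂ} (hc : c ≠ 0) {A B : S} (hB : B ≠ 0)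
    (h : ∑ i : Fin (N + 1), κ (c i) * (A ^ (i : ℕ) * B ^ (N - (i : ℕ))) = 0) :
    ∃ r : ℂ, ∑ i : Fin (N + 1), c i * r ^ (i : ℕ) = 0 ∧ A = κ r * B := by
  classical
  -- the polynomial `P = ∑ cᵢ Tⁱ ≠ 0`
  obtain ⟨P, hP⟩ : ∃ P : Polynomial ℂ,
      P = ∑ i : Fin (N + 1), Polynomial.C (c i) * Polynomial.X ^ (i : ℕ) := ⟨_, rfl⟩
  obtain ⟨i₀, hi₀⟩ := Function.ne_iff.1 hc
  have hcoeff : P.coeff i₀ = c i₀ := by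
    rw [hP, Polynomial.finsetSum_coeff, Finset.sum_eq_single i₀]
    · rw [Polynomial.coeff_C_mul_X_pow, if_pos rfl]
    · intro j _ hj
      rw [Polynomial.coeff_C_mul_X_pow, if_neg fun h => hj (Fin.ext h).symm]
    · exact fun h => absurd (Finset.mem_univ _) h
  have hP0 : P ≠ 0 := fun h0 => hi₀ (by rw [← hcoeff, h0, Polynomial.coeff_zero]; rfl)
  -- the fraction field `K` of `S`; `t = A / B`
  let K := FractionRing S
  let ι : S →+* K := algebraMap S K
  have hι : Function.Injective ι := IsFractionRing.injective S K
  have hιB : ι B ≠ 0 := (map_ne_zero_iff ι hι).2 hB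
  obtain ⟨t, ht⟩ : ∃ t : K, t = ι A / ι B := ⟨_, rfl⟩
  have hAt : ι A = t * ι B := by rw [ht, div_mul_cancel₀ _ hιB]
  -- `t` is a root of `P` in `K`: `B^N · P(t) = ∑ cᵢ Aⁱ B^{N-i} = 0`
  have hkey : ι (∑ i : Fin (N + 1), κ (c i) * (A ^ (i : ℕ) * B ^ (N - (i : ℕ)))) =
      (∑ i : Fin (N + 1), (ι.comp κ) (c i) * t ^ (i : ℕ)) * ι B ^ N := by
    rw [map_sum, Finset.sum_mul]
    refine Finset.sum_congr rfl fun i _ => ?_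
    rw [map_mul, map_mul, map_pow, map_pow, hAt, mul_pow,
      ← pow_mul_pow_sub (ι B) (Nat.lt_succ_iff.mp i.2), RingHom.comp_apply]
    ring
  have hroot : (P.map (ι.comp κ)).IsRoot t := by
    rw [Polynomial.IsRoot.def, hP, eval_map_sum_C_mul_X_pow]
    rw [h, map_zero] at hkey
    exact (mul_eq_zero.1 hkey.symm).resolve_right (pow_ne_zero _ hιB)
  -- `P` splits over `ℂ`, so `t = κ(r)` for a root `r ∈ ℂ` of `P`
  obtain ⟨r, hr⟩ := RingHom.mem_range.1
    (Polynomial.Splits.mem_range_of_isRoot (IsAlgClosed.splits P) hP0 hroot)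
  have hφ : Function.Injective (ι.comp κ) := (ι.comp κ).injective
  have hrP : P.IsRoot r := Polynomial.IsRoot.of_map (by rwa [hr]) hφ
  refine ⟨r, ?_, hι ?_⟩
  · rwa [Polynomial.IsRoot.def, hP, eval_sum_C_mul_X_pow] at hrP
  · rw [map_mul, hAt, ← hr, RingHom.comp_apply]

/-! ### §2 The theorem -/

/-- **stub_binaryFormCollapse — EVERY NONNEGATIVE BINARY-FORM RELATION MODULO THE PERMANENT IS
CARRIED BY ONE ANTIPODAL PAIR.**  For `n ≥ 1`, `u, u' ∈ ℝ≥0[x_ij]` not divisible by `per_n` over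
`ℝ`, nonnegative `c₀, …, c_N` not all zero and `per_n ∣ ∑ᵢ cᵢ uⁱ u'^{N-i}` over `ℝ`:
`per_n ∣ u + γ u'` over `ℝ` for some real `γ > 0`.  Proof in the domain `S_n = ℂ[x]/(per_n)`
(`perPoly_irreducible`): the classes satisfy `∑ c̄ᵢ ūⁱ ū'^{N-i} = 0` with `ū' ≠ 0`, so
`ū = r̄ ū'` for a complex root `r` of `∑ cᵢ Tⁱ` (`exists_root_of_binaryForm_eq_zero`, via the
fraction field and algebraic closedness of `ℂ`); `r` is real (imaginary parts, else `per_n ∣ u'`),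
nonzero (else `per_n ∣ u`) and not positive (`∑ cᵢ rⁱ > 0` for `r > 0`), so `γ = -r > 0` and
`per_n ∣ u + γ u'`, over `ℂ` and hence over `ℝ`. [folklore] -/
theorem stub_binaryFormCollapse (n N : ℕ) (hn : 1 ≤ n)
    (u u' : MvPolynomial (Fin n × Fin n) ℝ≥0)
    (hu : ¬ perPoly (Fin n) ℝ ∣ MvPolynomial.map NNReal.toRealHom u)
    (hu' : ¬ perPoly (Fin n) ℝ ∣ MvPolynomial.map NNReal.toRealHom u')
    (c : Fin (N + 1) → ℝ≥0) (hc : c ≠ 0)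
    (hdvd : perPoly (Fin n) ℝ ∣ MvPolynomial.map NNReal.toRealHom
      (∑ i : Fin (N + 1), c i • (u ^ (i : ℕ) * u' ^ (N - (i : ℕ))))) :
    ∃ γ : ℝ≥0, 0 < γ ∧ perPoly (Fin n) ℝ ∣ MvPolynomial.map NNReal.toRealHom (u + γ • u') := by
  classical
  haveI : Nonempty (Fin n) := ⟨⟨0, hn⟩⟩
  -- `S_n = ℂ[x]/(per_n)` is a domain
  haveI hprime : (Ideal.span {perPoly (Fin n) ℂ}).IsPrime :=
    (Ideal.span_singleton_prime (perPoly_ne_zero (Fin n) ℂ)).2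
      (UniqueFactorizationMonoid.irreducible_iff_prime.mp (perPoly_irreducible (n := Fin n) (R := ℂ)))
  haveI : IsDomain (MvPolynomial (Fin n × Fin n) ℂ ⧸ Ideal.span {perPoly (Fin n) ℂ}) :=
    (Ideal.Quotient.isDomain_iff_prime _).2 hprime
  -- the reduction map `Φ : ℝ≥0[x] → ℝ[x] → ℂ[x] → S_n` and the constants `κ : ℂ → S_n`
  obtain ⟨Φ, hΦdef⟩ : ∃ Φ : MvPolynomial (Fin n × Fin n) ℝ≥0 →+*
      MvPolynomial (Fin n × Fin n) ℂ ⧸ Ideal.span {perPoly (Fin n) ℂ},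
      Φ = (Ideal.Quotient.mk (Ideal.span {perPoly (Fin n) ℂ})).comp
        ((MvPolynomial.map Complex.ofRealHom).comp (MvPolynomial.map NNReal.toRealHom)) :=
    ⟨_, rfl⟩
  obtain ⟨κ, hκdef⟩ : ∃ κ : ℂ →+* MvPolynomial (Fin n × Fin n) ℂ ⧸ Ideal.span {perPoly (Fin n) ℂ},
      κ = (Ideal.Quotient.mk (Ideal.span {perPoly (Fin n) ℂ})).comp MvPolynomial.C := ⟨_, rfl⟩
  have hΦ : ∀ p, Φ p = Ideal.Quotient.mk (Ideal.span {perPoly (Fin n) ℂ})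
      (MvPolynomial.map Complex.ofRealHom (MvPolynomial.map NNReal.toRealHom p)) := fun p => by
    rw [hΦdef]; rfl
  have hκ : ∀ z, κ z = Ideal.Quotient.mk (Ideal.span {perPoly (Fin n) ℂ}) (C z) := fun z => by
    rw [hκdef]; rfl
  have hΦ0 : ∀ p, Φ p = 0 ↔ perPoly (Fin n) ℂ ∣
      MvPolynomial.map Complex.ofRealHom (MvPolynomial.map NNReal.toRealHom p) := fun p => by
    rw [hΦ, Ideal.Quotient.eq_zero_iff_mem, Ideal.mem_span_singleton]
  have hΦC : ∀ (b : ℝ≥0) (p : MvPolynomial (Fin n × Fin n) ℝ≥0),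
      Φ (b • p) = κ ((b : ℝ) : ℂ) * Φ p := by
    intro b p
    simp only [hΦ, hκ, smul_eq_C_mul, map_mul, MvPolynomial.map_C]
    rfl
  -- the relation `∑ c̄ᵢ ūⁱ ū'^{N-i} = 0` in `S_n`; `ū, ū' ≠ 0`
  have hrel : ∑ i : Fin (N + 1), κ ((c i : ℝ) : ℂ) * (Φ u ^ (i : ℕ) * Φ u' ^ (N - (i : ℕ))) = 0 := by
    have h := (hΦ0 _).2 (per_ascent hdvd)
    simpa only [map_sum, hΦC, map_mul, map_pow] using h
  have hA : Φ u ≠ 0 := fun h => hu (per_descent ((hΦ0 u).1 h))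
  have hB : Φ u' ≠ 0 := fun h => hu' (per_descent ((hΦ0 u').1 h))
  -- §1: `ū = r̄ ū'` for a complex root `r` of `∑ cᵢ Tⁱ`
  obtain ⟨i₀, hi₀⟩ := Function.ne_iff.1 hc
  have hi₀' : c i₀ ≠ 0 := hi₀
  have hc' : (fun i => ((c i : ℝ) : ℂ)) ≠ 0 := Function.ne_iff.2
    ⟨i₀, by simpa only [Pi.zero_apply, Ne, Complex.ofReal_eq_zero, NNReal.coe_eq_zero] using hi₀'⟩
  obtain ⟨r, hPr, hAB⟩ := exists_root_of_binaryForm_eq_zero κ hc' hB hrel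
  -- `per_n ∣ u - r u'` over `ℂ`
  have hdiv : perPoly (Fin n) ℂ ∣
      MvPolynomial.map Complex.ofRealHom (MvPolynomial.map NNReal.toRealHom u) -
        C r * MvPolynomial.map Complex.ofRealHom (MvPolynomial.map NNReal.toRealHom u') := by
    rw [← Ideal.mem_span_singleton, ← Ideal.Quotient.eq_zero_iff_mem, map_sub, map_mul, ← hΦ,
      ← hΦ, ← hκ, hAB, sub_self]
  -- `r` is real: otherwise `per_n ∣ u'`
  have hrim : r.im = 0 := by
    by_contra hrim
    exact hu' (dvd_of_map_dvd_sub_C_mul (r := MvPolynomial.map NNReal.toRealHom u) hrim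
      (by rwa [map_perPoly]))
  have hr : r = ((r.re : ℝ) : ℂ) := Complex.ext (by simp) (by simp [hrim])
  -- `r ≠ 0`: otherwise `ū = 0`
  have hre0 : r.re ≠ 0 := by
    intro hre0
    apply hA
    rw [hAB, hr, hre0, Complex.ofReal_zero, map_zero, zero_mul]
  -- `r < 0`: for `r > 0` the value `∑ cᵢ rⁱ` would be positive
  have hsum : ∑ i : Fin (N + 1), (c i : ℝ) * r.re ^ (i : ℕ) = 0 := by
    rw [hr] at hPr
    exact_mod_cast hPr
  have hneg : r.re < 0 := by
    by_contra hnn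
    have hpos : 0 < r.re := lt_of_le_of_ne (not_lt.1 hnn) (Ne.symm hre0)
    have : 0 < ∑ i : Fin (N + 1), (c i : ℝ) * r.re ^ (i : ℕ) :=
      Finset.sum_pos' (fun i _ => mul_nonneg (c i).coe_nonneg (pow_pos hpos _).le)
        ⟨i₀, Finset.mem_univ _, mul_pos (lt_of_le_of_ne (c i₀).coe_nonneg
          (Ne.symm (NNReal.coe_ne_zero.2 hi₀'))) (pow_pos hpos _)⟩
    exact this.ne' hsum
  -- `γ = -r > 0` and `ū + γ̄ ū' = 0`
  obtain ⟨γ, hγ0, hγ⟩ : ∃ γ : ℝ≥0, 0 < γ ∧ ((γ : ℝ) : ℂ) = -r :=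
    ⟨NNReal.mk (-r.re) (by linarith), NNReal.coe_pos.1 (show (0 : ℝ) < -r.re by linarith), by
      rw [NNReal.coe_mk, Complex.ofReal_neg, ← hr]⟩
  refine ⟨γ, hγ0, per_descent ((hΦ0 _).1 ?_)⟩
  rw [map_add, hΦC, hγ, hAB, ← add_mul, ← map_add, add_neg_cancel, map_zero, zero_mul]

end Summit.ValiantsHypothesis.ValiantsHypothesis.Theorems.DivisionGap.PerCofactorDegreeReduction.BinaryFormCollapse

end
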